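import Summits.CriticalPhenomena.PercolationContinuityZ3.Theorems.SahiMasterFamilyPointwiseSharedFaceVanishing

/-!
# Shared-face-vanishing families at EVERY order, from the face-vanishing class (the pipeline for future `F(k)` certificates)

Unit `prim-master-conj` (crux anchor stmt-CriticalPhenomena-4575, helper work), gen 13; companion of `…PointwiseSharedFaceVanishing` (orders `≤ 6`).
The induction on the joint essential support is order-free: its only order-dependent input is the statement "`C_k` and the pointwise zero locus on the
FACE-VANISHING class at the interior point `p`".  This file runs it with that statement as a HYPOTHESIS (`Hfv`) —
`sahiE_ind_nonneg_and_eq_zero_iff_of_shared_of_faceVanishing` — and plugs in the all-orders face-vanishing theorems of `…FaceVanishingAllOrders` /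
`…PointwisePrincipalCapSix`: **for every `n`, P4's `PhiNonneg (j+4)` and transferable `F(j+4)`-certificates (`PT`, the hypothesis of
`Pointwise.sahiE_ind_eq_zero_iff_of_principalCap_of_phiTransfer`) for `j ≤ n` give `C_{n+4}` and the pointwise master conjecture at every interior `p` on every
SHARED-face-vanishing `(n+4)`-family** (`sahiE_ind_nonneg_and_eq_zero_iff_of_sharedFaceVanishing_of_phiTransfer`).  At `n ≤ 2` all hypotheses are theorems
(`…PointwiseSharedFaceVanishing`); `F(7)` is the next input.  Axioms standard. [this work]
-/

noncomputable section

open scoped Classical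

namespace Summit.CriticalPhenomena.PercolationContinuityZ3.Theorems

open Finset Function
open Literature.Combinatorics.Sahi2008
open Literature.Probability.LatticeModels.Kahn2022 (Affects)
open Literature.Probability.Percolation (DeterminedBy)
open Literature.Probability.Percolation.DecisionTree (ind)
open PrincipalCapBeta

namespace Pointwise

variable {ι : Type} [Fintype ι]

/-- **Shared-face-vanishing from face-vanishing, any order `k = n+2`**: if at the point `p` every face-vanishing `k`-family `V` on `ι` (increasing, determined
by some `S`, all minors at `e ∈ S` zero flags) has `E_k(μ_p;1_V) ≥ 0` and `E_k(μ_p;1_V) = 0 ↔ V ∈ Z_k`, then the same holds for every `k`-family whose minors at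
SHARED coordinates are zero flags (induction on the joint essential support, private coordinates removed by `…PointwisePrivate`). [this work] -/
theorem sahiE_ind_nonneg_and_eq_zero_iff_of_shared_of_faceVanishing {n : ℕ} (p : ι → unitInterval)
    (hp : ∀ e, (p e : ℝ) ∈ Set.Ioo (0 : ℝ) 1)
    (Hfv : ∀ (V : Fin (n + 2) → Set (Set ι)) (S : Finset ι), (∀ j, IsUpperSet (V j)) → (∀ j, DeterminedBy (V j) (↑S : Set ι)) →
      (∀ e ∈ S, ∀ b : Bool, SuppZeroFlag (n + 2) (fun j => secAt e b (V j))) →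
        0 ≤ sahiE (bernoulliWeight p) (n + 2) (fun j => ind (V j)) ∧
          (sahiE (bernoulliWeight p) (n + 2) (fun j => ind (V j)) = 0 ↔ SuppZeroFlag (n + 2) V)) :
    ∀ (m : ℕ) (U : Fin (n + 2) → Set (Set ι)), (univ.biUnion fun j => esupp (U j)).card = m → (∀ j, IsUpperSet (U j)) →
      (∀ e, (∃ i j, i ≠ j ∧ Affects (U i) e ∧ Affects (U j) e) → ∀ b : Bool, SuppZeroFlag (n + 2) (fun j => secAt e b (U j))) →
        0 ≤ sahiE (bernoulliWeight p) (n + 2) (fun j => ind (U j)) ∧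
          (sahiE (bernoulliWeight p) (n + 2) (fun j => ind (U j)) = 0 ↔ SuppZeroFlag (n + 2) U) := by
  intro m
  induction m using Nat.strong_induction_on with
  | _ m ih =>
  intro U hm hU hsh
  by_cases hpriv : ∃ e ∈ (univ.biUnion fun j => esupp (U j)), ∃ i, ∀ j, j ≠ i → ¬ Affects (U j) e
  · obtain ⟨e, heT, i, hpi⟩ := hpriv
    have key : ∀ b : Bool,
        0 ≤ sahiE (bernoulliWeight p) (n + 2) (fun j => ind (update U i (secAt e b (U i)) j)) ∧
          (sahiE (bernoulliWeight p) (n + 2) (fun j => ind (update U i (secAt e b (U i)) j)) = 0 ↔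
            SuppZeroFlag (n + 2) (update U i (secAt e b (U i)))) := by
      intro b
      refine ih _ ?_ (update U i (secAt e b (U i))) rfl (isUpperSet_update_secAt hU i e b) ?_
      · have hsub : (univ.biUnion fun j => esupp (update U i (secAt e b (U i)) j)) ⊆
            (univ.biUnion fun j => esupp (U j)).erase e := by
          intro f hf
          obtain ⟨j, -, hj⟩ := mem_biUnion.1 hf
          refine mem_erase.2 ⟨?_, mem_biUnion.2 ⟨j, mem_univ _, esupp_update_secAt_subset U hU i e b j hj⟩⟩
          rintro rfl
          exact not_mem_esupp_update_secAt U i f hpi b j hj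
        rw [← hm]
        exact lt_of_le_of_lt (card_le_card hsub) (card_erase_lt_of_mem heT)
      · rintro f ⟨i', j', hij, hi', hj'⟩ b'
        have hfe : f ≠ e := by
          rintro rfl
          exact not_mem_esupp_update_secAt U i f hpi b i' (mem_esupp.2 hi')
        have hshU : ∃ i j, i ≠ j ∧ Affects (U i) f ∧ Affects (U j) f :=
          ⟨i', j', hij, mem_esupp.1 (esupp_update_secAt_subset U hU i e b i' (mem_esupp.2 hi')),
            mem_esupp.1 (esupp_update_secAt_subset U hU i e b j' (mem_esupp.2 hj'))⟩
        rw [secAt_update_secAt_eq U i hfe b b']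
        refine suppZeroFlag_update_secAt_of_private (fun j => secAt f b' (U j)) (fun j => isUpperSet_secAt f b' (hU j)) i e
          (fun j hj hje => hpi j hj ?_) b (hsh f hshU b')
        exact mem_esupp.1 (mem_of_mem_erase (esupp_secAt_subset (hU j) f b' (mem_esupp.2 hje)))
    obtain ⟨h0, hz0⟩ := key false
    obtain ⟨h1, hz1⟩ := key true
    exact ⟨sahiE_ind_nonneg_of_private_sections p U hU i e hpi h0 h1,
      sahiE_ind_eq_zero_iff_of_private_sections p hp U hU i e hpi h0 h1 hz0.1 hz1.1⟩
  · push Not at hpriv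
    set T : Finset ι := univ.biUnion fun j => esupp (U j) with hT
    have hUS : ∀ j, DeterminedBy (U j) (↑T : Set ι) := fun j =>
      (determinedBy_esupp (hU j)).mono (coe_subset.2 (subset_biUnion_of_mem (fun j => esupp (U j)) (mem_univ j)))
    have hall : ∀ e ∈ T, ∀ b : Bool, SuppZeroFlag (n + 2) (fun j => secAt e b (U j)) := by
      intro e he b
      obtain ⟨j₀, -, hj₀⟩ := mem_biUnion.1 he
      obtain ⟨j₁, hj₁, hj₁e⟩ := hpriv e he j₀
      exact hsh e ⟨j₁, j₀, hj₁, hj₁e, mem_esupp.1 hj₀⟩ b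
    exact Hfv U T hU hUS hall

/-- **The pipeline, every order `n+4`**: P4's `PhiNonneg (j+4)` and transferable `F(j+4)`-certificates for `j ≤ n` ⟹ `C_{n+4}` and the pointwise master
conjecture (interior `p`) on every SHARED-face-vanishing `(n+4)`-family. [this work] -/
theorem sahiE_ind_nonneg_and_eq_zero_iff_of_sharedFaceVanishing_of_phiTransfer (n : ℕ)
    (hΦ : ∀ j, j ≤ n → PhiNonneg (j + 4))
    (PT : ∀ j, j ≤ n → ∀ β β' : Finset (Fin (j + 3 + 1)) → ℝ, β univ = 1 → β' univ = 1 →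
        (∀ B, 0 ≤ β B ∧ 0 ≤ β' B ∧ (β B = 0 → β' B = 0)) →
        (∀ B, 0 ≤ 1 - β B ∧ 0 ≤ 1 - β' B ∧ (1 - β B = 0 → 1 - β' B = 0)) →
        (∀ S A B : Finset (Fin (j + 3 + 1)), A ∪ B = S →
          0 ≤ β S - β A * β B ∧ 0 ≤ β' S - β' A * β' B ∧ (β S - β A * β B = 0 → β' S - β' A * β' B = 0)) →
        phiSet (j + 3 + 1) β = 0 → phiSet (j + 3 + 1) β' = 0)
    (p : ι → unitInterval) (hp : ∀ e, (p e : ℝ) ∈ Set.Ioo (0 : ℝ) 1) (U : Fin (n + 4) → Set (Set ι)) (hU : ∀ j, IsUpperSet (U j))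
    (hsh : ∀ e, (∃ i j, i ≠ j ∧ Affects (U i) e ∧ Affects (U j) e) → ∀ b : Bool, SuppZeroFlag (n + 4) (fun j => secAt e b (U j))) :
    0 ≤ sahiE (bernoulliWeight p) (n + 4) (fun j => ind (U j)) ∧
      (sahiE (bernoulliWeight p) (n + 4) (fun j => ind (U j)) = 0 ↔ SuppZeroFlag (n + 4) U) :=
  sahiE_ind_nonneg_and_eq_zero_iff_of_shared_of_faceVanishing (n := n + 2) p hp
    (fun V S hV hVS hall => ⟨sahiE_ind_nonneg_of_faceVanishing_of_phiNonneg n hΦ ι p V S hV hVS hall,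
      sahiE_ind_eq_zero_iff_of_faceVanishing_of_phiTransfer n PT p hp V S hV hVS hall⟩) _ U rfl hU hsh

/-- The orders `≤ 6` recovered through the pipeline's first stage (sanity check of the statement; the tree's `…PointwiseSharedFaceVanishing` is the
direct proof). [this work] -/
theorem sahiE_ind_nonneg_and_eq_zero_iff_of_sharedFaceVanishing_via (n : ℕ) (hn : n + 2 ≤ 6) (p : ι → unitInterval)
    (hp : ∀ e, (p e : ℝ) ∈ Set.Ioo (0 : ℝ) 1) (U : Fin (n + 2) → Set (Set ι)) (hU : ∀ j, IsUpperSet (U j))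
    (hsh : ∀ e, (∃ i j, i ≠ j ∧ Affects (U i) e ∧ Affects (U j) e) → ∀ b : Bool, SuppZeroFlag (n + 2) (fun j => secAt e b (U j))) :
    0 ≤ sahiE (bernoulliWeight p) (n + 2) (fun j => ind (U j)) ∧
      (sahiE (bernoulliWeight p) (n + 2) (fun j => ind (U j)) = 0 ↔ SuppZeroFlag (n + 2) U) :=
  sahiE_ind_nonneg_and_eq_zero_iff_of_shared_of_faceVanishing p hp
    (fun V S hV hVS hall => ⟨sahiE_ind_nonneg_of_faceVanishing_of_le_six hn p V S hV hVS hall,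
      sahiE_ind_eq_zero_iff_of_faceVanishing_of_le_six hn p hp V S hV hVS hall⟩) _ U rfl hU hsh

end Pointwise

end Summit.CriticalPhenomena.PercolationContinuityZ3.Theorems
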